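import Summits.RiemannHypothesis.RiemannHypothesis.Theorems.WeilFormatCDataRungPiecesA
import Summits.RiemannHypothesis.RiemannHypothesis.Theorems.WeilFormatCBandedFar
import HarnessLib

/-!
# Format C: the data front door with a BANDED FAR FIELD (design "BF") under the certified prime constant `A`

Route context: Fourier–Galerkin / Schur-complement certificates of Weil positivity on a window ("format C";
cell memo `run/shared/lean/pub/rh-explicit/rh-explicit-weil-10/FORMATC-DESIGN.md` §9.11; supporting
stmt-RiemannHypothesis-0098; seat rh-explicit-weil-10).  This is `WeilFormatC.weilPositivityOn_of_formatC_bandedA`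
= `weilPositivityOn_of_formatC_piecesA` (p340268) with ONE change per sector: the far weights.  Instead of the
window-uniform diagonal `d̂_B(m)` (block start `B`, carrying `−A/2` and, odd, the Hilbert penalty from `B` on), the
far modes `m ∈ [B, B+b)` (the BAND) get arbitrary certified weights `θ m`, and the modes `m ≥ B+b` get
`(1 − ρ)·d̂_{B+b}(m)` (the old diagonal instantiated at the band END, where it is larger); the price is ONE band
certificate per sector (`hSde`/`hSdo`: band block − `diag θ` − `ρ⁻¹`·(exact band columns on `[B+b, M₃)` + a tail
majorant from `M₃`) positive semidefinite — the block-certificate shape, at low precision), discharged by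
`far_minorant_banded` (`WeilFormatCBandedFar`).  Everything else — exact block columns on `[B, B₃)`, the compressed
middle on `[B₃, B₄)`, the tail from `B₄ ≥ B+b`, the kernel PSD check — is verbatim `_piecesA` with the weight bounds
read against the new far weights.  Measured motive (weil-10 gen6, kit j173055): at `a = 1` the uniform `d̂`
over-states the true Schur loss `1.3–3.5×`, true-diagonal-like weights close at block `≈ 32–64` instead of `96–160`.

* `fin_append_zero_dotProduct_mulVec` — restriction of a quadratic form to a band via `Fin.append 0 z`;
* `weilPositivityOn_of_formatC_bandedA`.

Standard axioms; no definitions; no RH claim (a rung `WeilPositivityOn a` is one case of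
`riemannHypothesis_iff_forall_weilPositivityOn`).  GENERATED by `code/gen/gen_banded.py` (weil-10) — regenerate, do not hand-edit.
-/

set_option autoImplicit false
-- `Summit.RiemannHypothesis.RiemannHypothesis.…` is the layout-mandated namespace (summit = problem name).
set_option linter.dupNamespace false

noncomputable section

open Complex Finset Matrix
open scoped Real BigOperators ComplexConjugate ArithmeticFunction.vonMangoldt

namespace Summit.RiemannHypothesis.RiemannHypothesis.Theorems.WeilFormatC

open Literature.NumberTheory.LFunctions Literature.NumberTheory.LFunctions.Yoshida1992
open Literature.Analysis.SpecialFunctions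

variable {a : ℝ}

/-! ## Zero-extension of a band vector to the rows `0, …, B + b − 1` -/

/-- For `x = Fin.append 0 z`: the quadratic form of `U` is that of its band sub-block. -/
theorem fin_append_zero_dotProduct_mulVec {B b : ℕ} (U : Matrix (Fin (B + b)) (Fin (B + b)) ℝ) (z : Fin b → ℝ) :
    Fin.append (0 : Fin B → ℝ) z ⬝ᵥ U *ᵥ Fin.append (0 : Fin B → ℝ) z
      = z ⬝ᵥ (Matrix.of fun j j' : Fin b ↦ U (Fin.natAdd B j) (Fin.natAdd B j')) *ᵥ z := by
  simp only [dotProduct, mulVec, Matrix.of_apply]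
  rw [Fin.sum_univ_add]
  simp only [Fin.append_left, Pi.zero_apply, zero_mul, Finset.sum_const_zero, zero_add, Fin.append_right]
  refine Finset.sum_congr rfl fun j _ ↦ ?_
  congr 1
  rw [Fin.sum_univ_add]
  simp only [Fin.append_left, Pi.zero_apply, mul_zero, Finset.sum_const_zero, zero_add, Fin.append_right]

/-! ## The data-only rung theorem with a banded far field -/

section Rung

/-- **Format C, data front door with a BANDED far field under the certified prime constant `A` (design BF).**
See the module docstring.  Per sector: block `B`, band `[B, B+b)` with certified weights `θ`, exact band columns on
`[B+b, M₃)`, a band tail majorant from `M₃` (rows `Fin (B+b)` — the TJ shape at block `B+b`), the band certificate;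
then — as in `_piecesA` — exact block columns on `[B, B₃)`, a middle on `[B₃, B₄)`, the tail from `B₄ ≥ B+b`, all with
weights bounded by `θ` below `B+b` and by `(1−ρ)·d̂_{B+b}` from `B+b` on, and the kernel PSD check. -/
theorem weilPositivityOn_of_formatC_bandedA (ha : 0 < a)
    -- the certified PRIME constant of the window (`primeCoeff_form_ge_cells_*`, or `A_op⁺` via `primeCoeff_form_ge`)
    {A : ℝ} (hPA : ∀ (s : Finset ℤ) (c : ℤ → ℂ),
      -(A * ∑ n ∈ s, ‖c n‖ ^ 2) ≤ ∑ n ∈ s, ∑ m ∈ s, (conj (c n) * c m).re * primeCoeff a n m)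
    -- ================= EVEN sector =================
    -- block `Be`; band `[Be, Be+be)`; band exact columns `[Be+be, M3e)`; block exact columns `[Be, B3e)`;
    -- middle `[B3e, B4e)`; tail from `B4e ≥ Be+be`
    {Be be M3e B3e B4e : ℕ} (hBe : 2 ≤ Be) (hM3e : Be + be ≤ M3e)
    (hBBe : Be ≤ B3e) (hB34e : B3e ≤ B4e) (hMB4e : Be + be ≤ B4e)
    {ρe : ℝ} (hρe : 0 < ρe ∧ ρe < 1) (θe : ℕ → ℝ) (hθe : ∀ m, Be ≤ m → m < Be + be → 0 < θe m)
    -- the far diagonal (taken at the band end) is positive at the band end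
    (h0e : 0 < ((reDigammaQuarter (freq a ((Be + be : ℕ) : ℤ)) - Real.log π) / 2 - a * (1 + weilArchDensity (2 * a)) / (π ^ 2 * ((Be + be : ℕ) : ℝ) ^ 2) - 1 / (8 * ((Be + be : ℕ) : ℝ)) - a * (1 + weilArchDensity (2 * a)) / π ^ 2 * Real.sqrt (8 / ((Be + be - 1 : ℕ) : ℝ)) - A / 2))
    -- band pieces: exact band columns with weights `wde ≤ d̂`, band tail from `M3e` with floor `d0de`, band certificate
    (wde : ℕ → ℝ) (hwde : ∀ m, Be + be ≤ m → m < M3e → 0 < wde m ∧ wde m ≤ ((reDigammaQuarter (freq a m) - Real.log π) / 2 - a * (1 + weilArchDensity (2 * a)) / (π ^ 2 * m ^ 2) - 1 / (8 * m) - a * (1 + weilArchDensity (2 * a)) / π ^ 2 * Real.sqrt (8 / ((Be + be - 1 : ℕ) : ℝ)) - A / 2))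
    {d0de : ℝ} (hd0de : 0 < d0de ∧ d0de ≤ ((reDigammaQuarter (freq a M3e) - Real.log π) / 2 - a * (1 + weilArchDensity (2 * a)) / (π ^ 2 * M3e ^ 2) - 1 / (8 * M3e) - a * (1 + weilArchDensity (2 * a)) / π ^ 2 * Real.sqrt (8 / ((Be + be - 1 : ℕ) : ℝ)) - A / 2))
    (U2de : Matrix (Fin (Be + be)) (Fin (Be + be)) ℝ)
    (hU2de : ∀ d : ℕ → ℝ, (∀ m, M3e ≤ m → d0de ≤ d m) → ∀ (N : ℕ) (x : Fin (Be + be) → ℝ),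
      ∑ m ∈ Finset.Ico M3e N, (∑ i : Fin (Be + be), (if (i : ℕ) = 0 then gramCoeff a 0 m else if m = 0 then gramCoeff a i 0 else (gramCoeff a i m + gramCoeff a i (-(m : ℤ))) / 2) * x i) ^ 2 / d m ≤ x ⬝ᵥ U2de *ᵥ x)
    (hSde : ∀ z : Fin be → ℝ, 0 ≤ ∑ j, ∑ j', z j * z j' *
      (((gramCoeff a ((Be + j : ℕ) : ℤ) ((Be + j' : ℕ) : ℤ) + gramCoeff a ((Be + j : ℕ) : ℤ) (-(((Be + j' : ℕ) : ℤ) : ℤ))) / 2)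
        - (if (j : ℕ) = (j' : ℕ) then θe (Be + j) else 0)
        - ρe⁻¹ * (∑ m ∈ Finset.Ico (Be + be) M3e, ((gramCoeff a ((Be + j : ℕ) : ℤ) m + gramCoeff a ((Be + j : ℕ) : ℤ) (-(m : ℤ))) / 2) * ((gramCoeff a ((Be + j' : ℕ) : ℤ) m + gramCoeff a ((Be + j' : ℕ) : ℤ) (-(m : ℤ))) / 2) / wde m)
        - ρe⁻¹ * U2de (Fin.natAdd Be j) (Fin.natAdd Be j')))
    -- block pieces (as `_piecesA`, weights against the banded far weights)
    {d0e : ℝ} (we wme : ℕ → ℝ)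
    (hwe : ∀ m, Be ≤ m → m < B3e → 0 < we m ∧ we m ≤ (if m < Be + be then θe m else (1 - ρe) * ((reDigammaQuarter (freq a m) - Real.log π) / 2 - a * (1 + weilArchDensity (2 * a)) / (π ^ 2 * m ^ 2) - 1 / (8 * m) - a * (1 + weilArchDensity (2 * a)) / π ^ 2 * Real.sqrt (8 / ((Be + be - 1 : ℕ) : ℝ)) - A / 2)))
    (hwme : ∀ m, B3e ≤ m → m < B4e → 0 < wme m ∧ wme m ≤ (if m < Be + be then θe m else (1 - ρe) * ((reDigammaQuarter (freq a m) - Real.log π) / 2 - a * (1 + weilArchDensity (2 * a)) / (π ^ 2 * m ^ 2) - 1 / (8 * m) - a * (1 + weilArchDensity (2 * a)) / π ^ 2 * Real.sqrt (8 / ((Be + be - 1 : ℕ) : ℝ)) - A / 2)))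
    (hd0e : 0 < d0e ∧ d0e ≤ (1 - ρe) * ((reDigammaQuarter (freq a B4e) - Real.log π) / 2 - a * (1 + weilArchDensity (2 * a)) / (π ^ 2 * B4e ^ 2) - 1 / (8 * B4e) - a * (1 + weilArchDensity (2 * a)) / π ^ 2 * Real.sqrt (8 / ((Be + be - 1 : ℕ) : ℝ)) - A / 2))
    (Umide : Matrix (Fin Be) (Fin Be) ℝ)
    (hUmide : ∀ d : ℕ → ℝ, (∀ m, B3e ≤ m → m < B4e → 0 < wme m ∧ wme m ≤ d m) → ∀ x : Fin Be → ℝ,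
      ∑ m ∈ Finset.Ico B3e B4e, (∑ i : Fin Be, (if (i : ℕ) = 0 then gramCoeff a 0 m else if m = 0 then gramCoeff a i 0 else (gramCoeff a i m + gramCoeff a i (-(m : ℤ))) / 2) * x i) ^ 2 / d m
        ≤ x ⬝ᵥ Umide *ᵥ x)
    (U2e : Matrix (Fin Be) (Fin Be) ℝ)
    (hU2e : ∀ d : ℕ → ℝ, (∀ m, B4e ≤ m → d0e ≤ d m) → ∀ (N : ℕ) (x : Fin Be → ℝ),
      ∑ m ∈ Finset.Ico B4e N, (∑ i : Fin Be, (if (i : ℕ) = 0 then gramCoeff a 0 m else if m = 0 then gramCoeff a i 0 else (gramCoeff a i m + gramCoeff a i (-(m : ℤ))) / 2) * x i) ^ 2 / d m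
        ≤ x ⬝ᵥ U2e *ᵥ x)
    (hSe : ∀ x : Fin Be → ℝ, 0 ≤ ∑ i, ∑ i', x i * x i' *
      ((if (i : ℕ) = 0 then gramCoeff a 0 i' else if (i' : ℕ) = 0 then gramCoeff a i 0 else (gramCoeff a i i' + gramCoeff a i (-(i' : ℤ))) / 2)
        - (∑ m ∈ Finset.Ico Be B3e, (if (i : ℕ) = 0 then gramCoeff a 0 m else if m = 0 then gramCoeff a i 0 else (gramCoeff a i m + gramCoeff a i (-(m : ℤ))) / 2) * (if (i' : ℕ) = 0 then gramCoeff a 0 m else if m = 0 then gramCoeff a i' 0 else (gramCoeff a i' m + gramCoeff a i' (-(m : ℤ))) / 2) / we m)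
        - Umide i i' - U2e i i'))
    -- ================= ODD sector ================= (kernel index `k` = mode `k + 1`)
    {Bo bo M3o B3o B4o : ℕ} (hBo : 1 ≤ Bo) (hM3o : Bo + bo ≤ M3o)
    (hBBo : Bo ≤ B3o) (hB34o : B3o ≤ B4o) (hMB4o : Bo + bo ≤ B4o)
    {ρo : ℝ} (hρo : 0 < ρo ∧ ρo < 1) (θo : ℕ → ℝ) (hθo : ∀ l, Bo ≤ l → l < Bo + bo → 0 < θo l)
    (h0o : 0 < ((reDigammaQuarter (freq a (((Bo + bo : ℕ) : ℤ) + 1)) - Real.log π) / 2 - 1 / (8 * (((Bo + bo : ℕ) : ℝ) + 1)) - a * (1 + weilArchDensity (2 * a)) / (π ^ 2 * (((Bo + bo : ℕ) : ℝ) + 1) ^ 2) - π / 4 - a * (1 + weilArchDensity (2 * a)) / π ^ 2 * Real.sqrt (8 / ((Bo + bo : ℕ) : ℝ)) - A / 2 - (Real.exp (a / 2) - Real.exp (-(a / 2))) ^ 2 * a / (π ^ 2 * ((Bo + bo : ℕ) : ℝ))))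
    (wdo : ℕ → ℝ) (hwdo : ∀ l, Bo + bo ≤ l → l < M3o → 0 < wdo l ∧ wdo l ≤ ((reDigammaQuarter (freq a ((l : ℤ) + 1)) - Real.log π) / 2 - 1 / (8 * ((l : ℝ) + 1)) - a * (1 + weilArchDensity (2 * a)) / (π ^ 2 * ((l : ℝ) + 1) ^ 2) - (π / 2 - Real.arctan (Real.sqrt ((Bo + bo : ℕ) : ℝ) / Real.sqrt ((l : ℝ) + 1))) / 2 - a * (1 + weilArchDensity (2 * a)) / π ^ 2 * Real.sqrt (8 / ((Bo + bo : ℕ) : ℝ)) - A / 2 - (Real.exp (a / 2) - Real.exp (-(a / 2))) ^ 2 * a / (π ^ 2 * ((Bo + bo : ℕ) : ℝ))))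
    {d0do : ℝ} (hd0do : 0 < d0do ∧ d0do ≤ ((reDigammaQuarter (freq a ((M3o : ℤ) + 1)) - Real.log π) / 2 - 1 / (8 * ((M3o : ℝ) + 1)) - a * (1 + weilArchDensity (2 * a)) / (π ^ 2 * ((M3o : ℝ) + 1) ^ 2) - π / 4 - a * (1 + weilArchDensity (2 * a)) / π ^ 2 * Real.sqrt (8 / ((Bo + bo : ℕ) : ℝ)) - A / 2 - (Real.exp (a / 2) - Real.exp (-(a / 2))) ^ 2 * a / (π ^ 2 * ((Bo + bo : ℕ) : ℝ))))
    (U2do : Matrix (Fin (Bo + bo)) (Fin (Bo + bo)) ℝ)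
    (hU2do : ∀ d : ℕ → ℝ, (∀ l, M3o ≤ l → d0do ≤ d l) → ∀ (N : ℕ) (x : Fin (Bo + bo) → ℝ),
      ∑ l ∈ Finset.Ico M3o N, (∑ k : Fin (Bo + bo), ((gramCoeff a (((k : ℕ) : ℤ) + 1) ((l : ℤ) + 1) - gramCoeff a (((k : ℕ) : ℤ) + 1) (-((l : ℤ) + 1))) / 2) * x k) ^ 2 / d l ≤ x ⬝ᵥ U2do *ᵥ x)
    (hSdo : ∀ z : Fin bo → ℝ, 0 ≤ ∑ j, ∑ j', z j * z j' *
      (((gramCoeff a (((Bo + j : ℕ) : ℤ) + 1) (((Bo + j' : ℕ) : ℤ) + 1) - gramCoeff a (((Bo + j : ℕ) : ℤ) + 1) (-(((Bo + j' : ℕ) : ℤ) + 1))) / 2)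
        - (if (j : ℕ) = (j' : ℕ) then θo (Bo + j) else 0)
        - ρo⁻¹ * (∑ l ∈ Finset.Ico (Bo + bo) M3o, ((gramCoeff a (((Bo + j : ℕ) : ℤ) + 1) ((l : ℤ) + 1) - gramCoeff a (((Bo + j : ℕ) : ℤ) + 1) (-((l : ℤ) + 1))) / 2) * ((gramCoeff a (((Bo + j' : ℕ) : ℤ) + 1) ((l : ℤ) + 1) - gramCoeff a (((Bo + j' : ℕ) : ℤ) + 1) (-((l : ℤ) + 1))) / 2) / wdo l)
        - ρo⁻¹ * U2do (Fin.natAdd Bo j) (Fin.natAdd Bo j')))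
    {d0o : ℝ} (wo wmo : ℕ → ℝ)
    (hwo : ∀ l, Bo ≤ l → l < B3o → 0 < wo l ∧ wo l ≤ (if l < Bo + bo then θo l else (1 - ρo) * ((reDigammaQuarter (freq a ((l : ℤ) + 1)) - Real.log π) / 2 - 1 / (8 * ((l : ℝ) + 1)) - a * (1 + weilArchDensity (2 * a)) / (π ^ 2 * ((l : ℝ) + 1) ^ 2) - (π / 2 - Real.arctan (Real.sqrt ((Bo + bo : ℕ) : ℝ) / Real.sqrt ((l : ℝ) + 1))) / 2 - a * (1 + weilArchDensity (2 * a)) / π ^ 2 * Real.sqrt (8 / ((Bo + bo : ℕ) : ℝ)) - A / 2 - (Real.exp (a / 2) - Real.exp (-(a / 2))) ^ 2 * a / (π ^ 2 * ((Bo + bo : ℕ) : ℝ)))))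
    (hwmo : ∀ l, B3o ≤ l → l < B4o → 0 < wmo l ∧ wmo l ≤ (if l < Bo + bo then θo l else (1 - ρo) * ((reDigammaQuarter (freq a ((l : ℤ) + 1)) - Real.log π) / 2 - 1 / (8 * ((l : ℝ) + 1)) - a * (1 + weilArchDensity (2 * a)) / (π ^ 2 * ((l : ℝ) + 1) ^ 2) - (π / 2 - Real.arctan (Real.sqrt ((Bo + bo : ℕ) : ℝ) / Real.sqrt ((l : ℝ) + 1))) / 2 - a * (1 + weilArchDensity (2 * a)) / π ^ 2 * Real.sqrt (8 / ((Bo + bo : ℕ) : ℝ)) - A / 2 - (Real.exp (a / 2) - Real.exp (-(a / 2))) ^ 2 * a / (π ^ 2 * ((Bo + bo : ℕ) : ℝ)))))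
    (hd0o : 0 < d0o ∧ d0o ≤ (1 - ρo) * ((reDigammaQuarter (freq a ((B4o : ℤ) + 1)) - Real.log π) / 2 - 1 / (8 * ((B4o : ℝ) + 1)) - a * (1 + weilArchDensity (2 * a)) / (π ^ 2 * ((B4o : ℝ) + 1) ^ 2) - π / 4 - a * (1 + weilArchDensity (2 * a)) / π ^ 2 * Real.sqrt (8 / ((Bo + bo : ℕ) : ℝ)) - A / 2 - (Real.exp (a / 2) - Real.exp (-(a / 2))) ^ 2 * a / (π ^ 2 * ((Bo + bo : ℕ) : ℝ))))
    (Umido : Matrix (Fin Bo) (Fin Bo) ℝ)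
    (hUmido : ∀ d : ℕ → ℝ, (∀ l, B3o ≤ l → l < B4o → 0 < wmo l ∧ wmo l ≤ d l) → ∀ x : Fin Bo → ℝ,
      ∑ l ∈ Finset.Ico B3o B4o, (∑ k : Fin Bo, ((gramCoeff a (((k : ℕ) : ℤ) + 1) ((l : ℤ) + 1) - gramCoeff a (((k : ℕ) : ℤ) + 1) (-((l : ℤ) + 1))) / 2) * x k) ^ 2 / d l
        ≤ x ⬝ᵥ Umido *ᵥ x)
    (U2o : Matrix (Fin Bo) (Fin Bo) ℝ)
    (hU2o : ∀ d : ℕ → ℝ, (∀ l, B4o ≤ l → d0o ≤ d l) → ∀ (N : ℕ) (x : Fin Bo → ℝ),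
      ∑ l ∈ Finset.Ico B4o N, (∑ k : Fin Bo, ((gramCoeff a (((k : ℕ) : ℤ) + 1) ((l : ℤ) + 1) - gramCoeff a (((k : ℕ) : ℤ) + 1) (-((l : ℤ) + 1))) / 2) * x k) ^ 2 / d l
        ≤ x ⬝ᵥ U2o *ᵥ x)
    (hSo : ∀ x : Fin Bo → ℝ, 0 ≤ ∑ k, ∑ k', x k * x k' *
      (((gramCoeff a (((k : ℕ) : ℤ) + 1) (((k' : ℕ) : ℤ) + 1) - gramCoeff a (((k : ℕ) : ℤ) + 1) (-(((k' : ℕ) : ℤ) + 1))) / 2)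
        - (∑ l ∈ Finset.Ico Bo B3o, ((gramCoeff a (((k : ℕ) : ℤ) + 1) ((l : ℤ) + 1) - gramCoeff a (((k : ℕ) : ℤ) + 1) (-((l : ℤ) + 1))) / 2) * ((gramCoeff a (((k' : ℕ) : ℤ) + 1) ((l : ℤ) + 1) - gramCoeff a (((k' : ℕ) : ℤ) + 1) (-((l : ℤ) + 1))) / 2) / wo l)
        - Umido k k' - U2o k k')) :
    WeilPositivityOn a := by
  have hE0 : 0 < weilArchDensity (2 * a) := weilArchDensity_pos (by positivity)
  have hC : 0 ≤ a * (1 + weilArchDensity (2 * a)) := by positivity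
  -- the sector kernels and the banded far weights as functions
  set Mev : ℕ → ℕ → ℝ := fun i j ↦ (if i = 0 then gramCoeff a 0 j else if j = 0 then gramCoeff a i 0 else (gramCoeff a i j + gramCoeff a i (-(j : ℤ))) / 2) with hMev
  set Mod : ℕ → ℕ → ℝ := fun k l ↦ ((gramCoeff a ((k : ℤ) + 1) ((l : ℤ) + 1) - gramCoeff a ((k : ℤ) + 1) (-((l : ℤ) + 1))) / 2) with hMod
  set devM : ℕ → ℝ := fun m ↦ ((reDigammaQuarter (freq a m) - Real.log π) / 2 - a * (1 + weilArchDensity (2 * a)) / (π ^ 2 * m ^ 2) - 1 / (8 * m) - a * (1 + weilArchDensity (2 * a)) / π ^ 2 * Real.sqrt (8 / ((Be + be - 1 : ℕ) : ℝ)) - A / 2) with hdevM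
  set dodM : ℕ → ℝ := fun l ↦ ((reDigammaQuarter (freq a ((l : ℤ) + 1)) - Real.log π) / 2 - 1 / (8 * ((l : ℝ) + 1)) - a * (1 + weilArchDensity (2 * a)) / (π ^ 2 * ((l : ℝ) + 1) ^ 2) - (π / 2 - Real.arctan (Real.sqrt ((Bo + bo : ℕ) : ℝ) / Real.sqrt ((l : ℝ) + 1))) / 2 - a * (1 + weilArchDensity (2 * a)) / π ^ 2 * Real.sqrt (8 / ((Bo + bo : ℕ) : ℝ)) - A / 2 - (Real.exp (a / 2) - Real.exp (-(a / 2))) ^ 2 * a / (π ^ 2 * ((Bo + bo : ℕ) : ℝ))) with hdodM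
  set dθe : ℕ → ℝ := fun m ↦ if m < Be + be then θe m else (1 - ρe) * devM m with hdθe
  set dθo : ℕ → ℝ := fun l ↦ if l < Bo + bo then θo l else (1 - ρo) * dodM l with hdθo
  have hMev_symm : ∀ n m, Mev n m = Mev m n :=
    fun n m ↦ evenKernel_symm (gramCoeff a) (gramCoeff_comm a) (gramCoeff_neg_neg a) n m
  have hMod_symm : ∀ k l, Mod k l = Mod l k :=
    fun k l ↦ oddKernel_symm (gramCoeff a) (gramCoeff_comm a) (gramCoeff_neg_neg a) k l
  refine weilPositivityOn_of_sector_kernels_nonneg ha (gramCoeff a) (weilWindowSesq_chi ha) (gramCoeff_neg_neg a)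
    ?_ ?_
  · -- ================= EVEN sector =================
    intro K y
    have hBe' : 2 ≤ Be + be := by omega
    -- positivity / monotonicity of the far diagonal from the band end on
    have hdMmono : ∀ m m', 1 ≤ m → m ≤ m' → devM m ≤ devM m' := fun m m' hm hmm' ↦ by
      simp only [hdevM]
      have h := even_dhat_core_mono ha hC hm hmm'
      linarith
    have hdM : ∀ m, Be + be ≤ m → 0 < devM m := fun m hm ↦ by
      have h := hdMmono (Be + be) m (by omega) hm
      have h0 : 0 < devM (Be + be) := by simp only [hdevM]; exact h0e
      linarith
    have hd : ∀ m, Be ≤ m → 0 < dθe m := fun m hm ↦ by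
      simp only [hdθe]
      by_cases hmM : m < Be + be
      · rw [if_pos hmM]; exact hθe m hm hmM
      · rw [if_neg hmM]; exact mul_pos (by linarith [hρe.2]) (hdM m (by omega))
    -- band rows are never the row 0
    have hband : ∀ (j : Fin be) (m : ℕ), Mev (Be + j) m = ((gramCoeff a (((Be + j : ℕ)) : ℤ) m + gramCoeff a (((Be + j : ℕ)) : ℤ) (-(m : ℤ))) / 2) := by
      intro j m
      have hne : (Be + (j : ℕ) : ℕ) ≠ 0 := by omega
      simp only [hMev, if_neg hne]
      by_cases hm : m = 0
      · subst hm
        rw [if_pos rfl]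
        simp only [Nat.cast_zero, neg_zero]
        ring
      · rw [if_neg hm]
    -- the old far inequality at the band end `Be + be`
    have hfarM : ∀ (N : ℕ) (y : ℕ → ℝ),
        ∑ n ∈ Finset.Ico (Be + be) N, devM n * y n ^ 2
          ≤ ∑ n ∈ Finset.Ico (Be + be) N, ∑ m ∈ Finset.Ico (Be + be) N, y n * Mev n m * y m := fun N y ↦ by
      simp only [hdevM, hMev]
      exact gramCoeff_even_far_ge_diag_A ha hPA hBe' N y
    -- band piece 1: exact band columns on `[Be+be, M3e)`
    have hU1d : ∀ z : Fin be → ℝ,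
        ∑ m ∈ Finset.Ico (Be + be) M3e, (∑ j : Fin be, Mev (Be + j) m * z j) ^ 2 / devM m
          ≤ z ⬝ᵥ (Matrix.of fun j j' : Fin be ↦
              ∑ m ∈ Finset.Ico (Be + be) M3e, Mev (Be + j) m * Mev (Be + j') m / wde m) *ᵥ z :=
      fun z ↦ columns_majorant (Finset.Ico (Be + be) M3e) (fun m j ↦ Mev (Be + j) m) devM wde
        (fun m hm ↦ by
          have hm := Finset.mem_Ico.mp hm
          have h := hwde m hm.1 hm.2
          simp only [hdevM]
          exact h) z
    -- band piece 2: the band tail from `M3e` (the rows-`Fin (Be+be)` majorant restricted to the band)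
    have hU2d : ∀ (N : ℕ) (z : Fin be → ℝ),
        ∑ m ∈ Finset.Ico M3e N, (∑ j : Fin be, Mev (Be + j) m * z j) ^ 2 / devM m
          ≤ z ⬝ᵥ (Matrix.of fun j j' : Fin be ↦ U2de (Fin.natAdd Be j) (Fin.natAdd Be j')) *ᵥ z := by
      intro N z
      have hmono : ∀ m, M3e ≤ m → d0de ≤ devM m := fun m hm ↦ by
        have h1 : d0de ≤ devM M3e := by simp only [hdevM]; exact hd0de.2
        exact le_trans h1 (hdMmono M3e m (by omega) hm)
      have h := hU2de devM hmono N (Fin.append (0 : Fin Be → ℝ) z)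
      rw [fin_append_zero_dotProduct_mulVec] at h
      simp only [Fin.sum_univ_add, Fin.append_left, Fin.append_right, Pi.zero_apply, mul_zero,
        Finset.sum_const_zero, zero_add, Fin.val_castAdd, Fin.val_natAdd] at h
      simp only [hMev]
      exact h
    -- the band certificate in the shape `far_minorant_banded` wants
    have hSd : ∀ z : Fin be → ℝ, 0 ≤ ∑ j, ∑ j', z j * z j' *
        (Mev (Be + j) (Be + j') - (if (j : ℕ) = (j' : ℕ) then θe (Be + j) else 0)
          - ρe⁻¹ * (Matrix.of fun j j' : Fin be ↦
              ∑ m ∈ Finset.Ico (Be + be) M3e, Mev (Be + j) m * Mev (Be + j') m / wde m) j j'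
          - ρe⁻¹ * (Matrix.of fun j j' : Fin be ↦ U2de (Fin.natAdd Be j) (Fin.natAdd Be j')) j j') := by
      intro z
      refine (hSde z).trans_eq (Finset.sum_congr rfl fun j _ ↦ Finset.sum_congr rfl fun j' _ ↦ ?_)
      simp only [Matrix.of_apply, hband]
    -- the banded far inequality from `Be` on
    have hfar : ∀ (N : ℕ) (y : ℕ → ℝ),
        ∑ n ∈ Finset.Ico Be N, dθe n * y n ^ 2 ≤ ∑ n ∈ Finset.Ico Be N, ∑ m ∈ Finset.Ico Be N, y n * Mev n m * y m := by
      intro N y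
      have h := far_minorant_banded Mev hMev_symm Be be (M3e - Be) (by omega) θe devM hρe.1 hdM hfarM
        (Matrix.of fun j j' : Fin be ↦ ∑ m ∈ Finset.Ico (Be + be) M3e, Mev (Be + j) m * Mev (Be + j') m / wde m)
        (Matrix.of fun j j' : Fin be ↦ U2de (Fin.natAdd Be j) (Fin.natAdd Be j'))
        (fun z ↦ by rw [show Be + (M3e - Be) = M3e by omega]; exact hU1d z)
        (fun N z ↦ by rw [show Be + (M3e - Be) = M3e by omega]; exact hU2d N z) hSd N y
      simpa only [hdθe] using h
    -- block pieces against the banded weights (verbatim `_piecesA` with `dθe`)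
    have hdmono : ∀ m, B4e ≤ m → d0e ≤ dθe m := fun m hm ↦ by
      have hnot : ¬ m < Be + be := by omega
      simp only [hdθe, if_neg hnot]
      refine le_trans hd0e.2 ?_
      have h := hdMmono B4e m (by omega) hm
      have h4 : devM B4e = ((reDigammaQuarter (freq a B4e) - Real.log π) / 2 - a * (1 + weilArchDensity (2 * a)) / (π ^ 2 * B4e ^ 2) - 1 / (8 * B4e) - a * (1 + weilArchDensity (2 * a)) / π ^ 2 * Real.sqrt (8 / ((Be + be - 1 : ℕ) : ℝ)) - A / 2) := by simp only [hdevM]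
      rw [← h4]
      exact mul_le_mul_of_nonneg_left h (by linarith [hρe.2])
    have hU1 : ∀ x : Fin Be → ℝ,
        ∑ m ∈ Finset.Ico Be B3e, (∑ i : Fin Be, Mev i m * x i) ^ 2 / dθe m
          ≤ x ⬝ᵥ (Matrix.of fun i j : Fin Be ↦ ∑ m ∈ Finset.Ico Be B3e, Mev i m * Mev j m / we m) *ᵥ x :=
      fun x ↦ columns_majorant (Finset.Ico Be B3e) (fun m i ↦ Mev i m) dθe we
        (fun m hm ↦ by
          have hm := Finset.mem_Ico.mp hm
          have h := hwe m hm.1 hm.2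
          simp only [hdθe, hdevM]
          exact h) x
    have hmid : ∀ x : Fin Be → ℝ,
        ∑ m ∈ Finset.Ico B3e B4e, (∑ i : Fin Be, Mev i m * x i) ^ 2 / dθe m ≤ x ⬝ᵥ Umide *ᵥ x := fun x ↦ by
      have h := hUmide dθe (fun m hm hm' ↦ by
        have h := hwme m hm hm'
        simp only [hdθe, hdevM]
        exact h) x
      simp only [hMev, hdθe] at h ⊢
      exact h
    have htail : ∀ (N : ℕ) (x : Fin Be → ℝ),
        ∑ m ∈ Finset.Ico B4e N, (∑ i : Fin Be, Mev i m * x i) ^ 2 / dθe m ≤ x ⬝ᵥ U2e *ᵥ x := fun N x ↦ by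
      have h := hU2e dθe hdmono N x
      simp only [hMev, hdθe] at h ⊢
      exact h
    have hU2 : ∀ (N : ℕ) (x : Fin Be → ℝ),
        ∑ m ∈ Finset.Ico B3e N, (∑ i : Fin Be, Mev i m * x i) ^ 2 / dθe m ≤ x ⬝ᵥ (Umide + U2e) *ᵥ x := by
      intro N x
      have hnn : ∀ m, B3e ≤ m → 0 ≤ (∑ i : Fin Be, Mev i m * x i) ^ 2 / dθe m := fun m hm ↦
        div_nonneg (sq_nonneg _) (hd m (by omega)).le
      rw [Matrix.add_mulVec, dotProduct_add]
      refine le_trans ?_ (add_le_add (hmid x) (htail N x))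
      exact sum_Ico_le_sum_Ico_add_sum_Ico hB34e hnn
    have key := sum_range_mul_mul_nonneg_of_certificate_sum_split Mev hMev_symm
      Be B3e hBBe dθe _ _ hd hfar hU1 hU2 (fun x ↦ by
        refine (hSe x).trans_eq (Finset.sum_congr rfl fun i _ ↦ Finset.sum_congr rfl fun i' _ ↦ ?_)
        simp only [hMev, Matrix.of_apply, Matrix.add_apply]
        ring) K y
    simpa only [hMev] using key
  · -- ================= ODD sector =================
    intro K z
    have hBo' : 1 ≤ Bo + bo := by omega
    -- positivity / floor of the far diagonal from the band end on
    have hfloor : ∀ l₀ l : ℕ, l₀ ≤ l → ((reDigammaQuarter (freq a ((l₀ : ℤ) + 1)) - Real.log π) / 2 - 1 / (8 * ((l₀ : ℝ) + 1)) - a * (1 + weilArchDensity (2 * a)) / (π ^ 2 * ((l₀ : ℝ) + 1) ^ 2) - π / 4 - a * (1 + weilArchDensity (2 * a)) / π ^ 2 * Real.sqrt (8 / ((Bo + bo : ℕ) : ℝ)) - A / 2 - (Real.exp (a / 2) - Real.exp (-(a / 2))) ^ 2 * a / (π ^ 2 * ((Bo + bo : ℕ) : ℝ))) ≤ dodM l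 := fun l₀ l hl ↦ by
      simp only [hdodM]
      have h := odd_dhat_core_mono ha hC hl
      have hpen := hilbert_atan_penalty_le (Bo + bo) l
      linarith
    have hdM : ∀ l, Bo + bo ≤ l → 0 < dodM l := fun l hl ↦ by
      have h := hfloor (Bo + bo) l hl
      linarith [h0o]
    have hd : ∀ l, Bo ≤ l → 0 < dθo l := fun l hl ↦ by
      simp only [hdθo]
      by_cases hlM : l < Bo + bo
      · rw [if_pos hlM]; exact hθo l hl hlM
      · rw [if_neg hlM]; exact mul_pos (by linarith [hρo.2]) (hdM l (by omega))
    -- the old far inequality at the band end `Bo + bo`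
    have hfarM : ∀ (N : ℕ) (y : ℕ → ℝ),
        ∑ n ∈ Finset.Ico (Bo + bo) N, dodM n * y n ^ 2
          ≤ ∑ n ∈ Finset.Ico (Bo + bo) N, ∑ m ∈ Finset.Ico (Bo + bo) N, y n * Mod n m * y m := fun N y ↦ by
      simp only [hdodM, hMod]
      exact gramCoeff_odd_far_ge_diag_atan_A ha hPA hBo' N y
    -- band piece 1: exact band columns on `[Bo+bo, M3o)`
    have hU1d : ∀ w : Fin bo → ℝ,
        ∑ l ∈ Finset.Ico (Bo + bo) M3o, (∑ j : Fin bo, Mod (Bo + j) l * w j) ^ 2 / dodM l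
          ≤ w ⬝ᵥ (Matrix.of fun j j' : Fin bo ↦
              ∑ l ∈ Finset.Ico (Bo + bo) M3o, Mod (Bo + j) l * Mod (Bo + j') l / wdo l) *ᵥ w :=
      fun w ↦ columns_majorant (Finset.Ico (Bo + bo) M3o) (fun l j ↦ Mod (Bo + j) l) dodM wdo
        (fun l hl ↦ by
          have hl := Finset.mem_Ico.mp hl
          have h := hwdo l hl.1 hl.2
          simp only [hdodM]
          exact h) w
    -- band piece 2: the band tail from `M3o`
    have hU2d : ∀ (N : ℕ) (w : Fin bo → ℝ),
        ∑ l ∈ Finset.Ico M3o N, (∑ j : Fin bo, Mod (Bo + j) l * w j) ^ 2 / dodM l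
          ≤ w ⬝ᵥ (Matrix.of fun j j' : Fin bo ↦ U2do (Fin.natAdd Bo j) (Fin.natAdd Bo j')) *ᵥ w := by
      intro N w
      have hmono : ∀ l, M3o ≤ l → d0do ≤ dodM l := fun l hl ↦ le_trans hd0do.2 (hfloor M3o l hl)
      have h := hU2do dodM hmono N (Fin.append (0 : Fin Bo → ℝ) w)
      rw [fin_append_zero_dotProduct_mulVec] at h
      simp only [Fin.sum_univ_add, Fin.append_left, Fin.append_right, Pi.zero_apply, mul_zero,
        Finset.sum_const_zero, zero_add, Fin.val_castAdd, Fin.val_natAdd] at h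
      simp only [hMod]
      exact h
    have hSd : ∀ w : Fin bo → ℝ, 0 ≤ ∑ j, ∑ j', w j * w j' *
        (Mod (Bo + j) (Bo + j') - (if (j : ℕ) = (j' : ℕ) then θo (Bo + j) else 0)
          - ρo⁻¹ * (Matrix.of fun j j' : Fin bo ↦
              ∑ l ∈ Finset.Ico (Bo + bo) M3o, Mod (Bo + j) l * Mod (Bo + j') l / wdo l) j j'
          - ρo⁻¹ * (Matrix.of fun j j' : Fin bo ↦ U2do (Fin.natAdd Bo j) (Fin.natAdd Bo j')) j j') := by
      intro w
      refine (hSdo w).trans_eq (Finset.sum_congr rfl fun j _ ↦ Finset.sum_congr rfl fun j' _ ↦ ?_)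
      simp only [Matrix.of_apply, hMod]
    have hfar : ∀ (N : ℕ) (y : ℕ → ℝ),
        ∑ n ∈ Finset.Ico Bo N, dθo n * y n ^ 2 ≤ ∑ n ∈ Finset.Ico Bo N, ∑ m ∈ Finset.Ico Bo N, y n * Mod n m * y m := by
      intro N y
      have h := far_minorant_banded Mod hMod_symm Bo bo (M3o - Bo) (by omega) θo dodM hρo.1 hdM hfarM
        (Matrix.of fun j j' : Fin bo ↦ ∑ l ∈ Finset.Ico (Bo + bo) M3o, Mod (Bo + j) l * Mod (Bo + j') l / wdo l)
        (Matrix.of fun j j' : Fin bo ↦ U2do (Fin.natAdd Bo j) (Fin.natAdd Bo j'))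
        (fun w ↦ by rw [show Bo + (M3o - Bo) = M3o by omega]; exact hU1d w)
        (fun N w ↦ by rw [show Bo + (M3o - Bo) = M3o by omega]; exact hU2d N w) hSd N y
      simpa only [hdθo] using h
    -- block pieces against the banded weights
    have hdlow : ∀ l, B4o ≤ l → d0o ≤ dθo l := fun l hl ↦ by
      have hnot : ¬ l < Bo + bo := by omega
      simp only [hdθo, if_neg hnot]
      refine le_trans hd0o.2 ?_
      exact mul_le_mul_of_nonneg_left (hfloor B4o l hl) (by linarith [hρo.2])
    have hU1 : ∀ x : Fin Bo → ℝ,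
        ∑ l ∈ Finset.Ico Bo B3o, (∑ k : Fin Bo, Mod k l * x k) ^ 2 / dθo l
          ≤ x ⬝ᵥ (Matrix.of fun k k' : Fin Bo ↦ ∑ l ∈ Finset.Ico Bo B3o, Mod k l * Mod k' l / wo l) *ᵥ x :=
      fun x ↦ columns_majorant (Finset.Ico Bo B3o) (fun l k ↦ Mod k l) dθo wo
        (fun l hl ↦ by
          have hl := Finset.mem_Ico.mp hl
          have h := hwo l hl.1 hl.2
          simp only [hdθo, hdodM]
          exact h) x
    have hmid : ∀ x : Fin Bo → ℝ,
        ∑ l ∈ Finset.Ico B3o B4o, (∑ k : Fin Bo, Mod k l * x k) ^ 2 / dθo l ≤ x ⬝ᵥ Umido *ᵥ x := fun x ↦ by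
      have h := hUmido dθo (fun l hl hl' ↦ by
        have h := hwmo l hl hl'
        simp only [hdθo, hdodM]
        exact h) x
      simp only [hMod, hdθo] at h ⊢
      exact h
    have htail : ∀ (N : ℕ) (x : Fin Bo → ℝ),
        ∑ l ∈ Finset.Ico B4o N, (∑ k : Fin Bo, Mod k l * x k) ^ 2 / dθo l ≤ x ⬝ᵥ U2o *ᵥ x := fun N x ↦ by
      have h := hU2o dθo hdlow N x
      simp only [hMod, hdθo] at h ⊢
      exact h
    have hU2 : ∀ (N : ℕ) (x : Fin Bo → ℝ),
        ∑ l ∈ Finset.Ico B3o N, (∑ k : Fin Bo, Mod k l * x k) ^ 2 / dθo l ≤ x ⬝ᵥ (Umido + U2o) *ᵥ x := by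
      intro N x
      have hnn : ∀ l, B3o ≤ l → 0 ≤ (∑ k : Fin Bo, Mod k l * x k) ^ 2 / dθo l := fun l hl ↦
        div_nonneg (sq_nonneg _) (hd l (by omega)).le
      rw [Matrix.add_mulVec, dotProduct_add]
      refine le_trans ?_ (add_le_add (hmid x) (htail N x))
      exact sum_Ico_le_sum_Ico_add_sum_Ico hB34o hnn
    have key := sum_range_mul_mul_nonneg_of_certificate_sum_split Mod hMod_symm
      Bo B3o hBBo dθo _ _ hd hfar hU1 hU2 (fun x ↦ by
        refine (hSo x).trans_eq (Finset.sum_congr rfl fun k _ ↦ Finset.sum_congr rfl fun k' _ ↦ ?_)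
        simp only [hMod, Matrix.of_apply, Matrix.add_apply]
        ring) K z
    simpa only [hMod] using key

end Rung

end Summit.RiemannHypothesis.RiemannHypothesis.Theorems.WeilFormatC

end
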